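import Summits.QuantumFields.YangMills.Theses.HyperbolicRegulator
import Literature.MathematicalPhysics.QuantumLattice.LatticeGaugeDLRGibbsProofs

/-!
# Line `uniqueness-transfer` for crux `HyperbolicToTorusR` (stmt-QuantumFields-18156) — `Lines/uniqueness-transfer.lean`

Strategist `planner-cstrat-stmt-QuantumFields-18156-b1-0` (crux-strategist BEFORE the lead, 2026-08-17), route
`route-QuantumFields-HyperbolicRegulator`, rank-4 crux (REPAIRED decl: flat `k/2 <`, deep `3(k/4) <`, k-UNIFORM constants R2).
Namespace `Summit.QuantumFields.YangMills.Cruxes.HyperbolicToTorusR.UniquenessTransfer`.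

## The cut: H → U → V (the ALT line; the sibling crux `FibreToTorus` owns U and V verbatim)

The crux says: an admissible hyperbolic family whose chart-read gauge-invariant local observables cluster at ONE rate `m(β)`
with `k`-uniform constants at every `β ≥ β₁` forces the symmetric-torus weak-coupling gap (`UniformLatticeGap` body at `(G, r)`).
Its conclusion ignores the family (`UniformLatticeGap → HyperbolicToTorusR`, refuter Probes18156.lean), so every proof must
cash the family into an infinite-volume FLAT object and then identify that object with the periodic theory.  This line does
so in the three steps the sibling crux `ContractibleFibre.FibreToTorus` (stmt-QuantumFields-16244) already runs, so that ONE
proof of each shared open step closes both cruxes: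

* `stub_chartLimitState` (H, buildable now, size M–L) — for every pair of species `(A, B)`: the family at `(β, m)` yields a
  DLR state `μ ∈ ymGibbsMeasures r.ρ β` of Wilson's `ℤ⁴` specification in which `(A, τₙB)` cluster in Euclidean time at the
  family's rate `m` (read the law of the configuration through the product chart `P x x'` at a deep base pair of
  `S_(k,j) × S_(k,j)`, `k → ∞`, `j ≥ j₀(A∘g, B∘g', k)` for the finitely many frame images `g, g' ∈ D₄`; compactness of
  `G^{edges}` in the LOCAL TOTAL-VARIATION topology — equicontinuous DLR densities — so bounded MEASURABLE species pass to the
  limit; DLR inside charts; chart rigidity turns "B read through the chart of the flat point at chart offset n e₀" into a frame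
  image of `τₙB`; graph distance = ℓ¹ chart distance below the chart scale).  The hyperbolic analogue of the sibling's LANDED
  `stub_tubeLimitState` (p159851); its helpers `Theorems.FibreToTorus.tubeLimit_dlrLimit` (weak limit + eventual local DLR ⇒ DLR
  limit AND convergence on bounded measurable cylinder functions) and `tubeLimit_localDLR` (DLR inside an injective chart of ANY
  finite complex carrying Wilson's weight on the chart) apply verbatim; only the chart-split of the `Fam` action (three square
  sorts ↔ six plaquette orientations) is new.  Per pair `(A, B)` because the crux's `j₀` depends on `(A, B, k)` with no
  uniformity (a single sequence cannot serve uncountably many pairs; an ultrafilter on the eventual sets would, but is not needed).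
* `stub_gaugeInvariantUniqueness` (U, OPEN, shared) — VERBATIM `Cruxes/FibreToTorus/Lines/uniqueness.lean`'s
  `GaugeInvariantUniqueness`: at weak coupling any two DLR states agree on every `YMSpecies`.  Rate-free and summit-INDEPENDENT
  (expected for U(1), which violates the target); recorded sibling verdict `stub-blocked:
  CertificationLength.CompleteAnalyticityAtLargeScales` (U ⇐ CA kernel-checked there).
* `stub_torusFiniteSize` (V, OPEN, shared) — VERBATIM the sibling's `TorusFiniteSize` (= `birth`'s `VacuumDominance`): periodic
  limit points clustering at one rate with limit-point-uniform constants ⇒ the `UniformLatticeGap` body.  Recorded sibling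
  verdict `stub-blocked: OneCertifiedCube.FiniteSizeCriterion`.
* `HyperbolicToTorusR_of : H → U → V → HyperbolicToTorusR` — PROVED below without `sorry`: fix `G, r`, the Borel σ-algebra
  (`letI := borel G` as the crux does), `β₁` from the crux hypothesis, `β_u` from U; at `β ≥ max β₁ β_u` and for each pair
  `(A, B)`, H gives a DLR `μ` in which `(A, τₙB)` cluster at the FAMILY's rate `m(β)` with constant `C`; a periodic limit point
  `ν` is DLR (LANDED `mem_ymGibbsMeasures_of_mem_infiniteVolumeLimitPoints_holds`), so U transports `∫A`, `∫τₙB`, `∫A·τₙB`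
  (`shiftObs`, `prodObs`) from `μ` to `ν`; V at threshold `max β₁ β_u` is the crux conclusion.  The crux hypotheses are
  load-bearing (admissibility: charts/DLR inside charts in H; clustering: the rate and constants of every periodic state).

## Disproof used / negatives

No `Cruxes/HyperbolicToTorusR/Disproof.lean` exists yet (payload `disproof_path` absent on disk, 2026-08-17).  Honoured from the
legacy `Cruxes/HyperbolicToTorus/Disproof.lean` (F0–F3, all still valid for the repaired decl): F0 (no `_false_without_` lemma can
exist; `S → C`) — the line never claims more than `UniformLatticeGap`-compatible content and U, V are summit-independent /
weaker-than-target; F2 (both hypotheses idle for truth) — here both are USED (H consumes admissibility and the clustering table);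
F3 is the R2 repair (constants before `k`), which is exactly what lets H inherit `C(A, B)`; F1/vacuity is gone (refuter
VETTING-18156: AdmR holds on the exact `{4,5}_k` Bring model, k = 8..20).  Negatives index (`ledger negatives`): no DLR /
uniqueness / finite-size statement among the refuted items.  Typing checklist 4c(ii): all integrands bounded measurable cylinder
functions under probability measures (`IsGibbsMeasure` carries `IsProbabilityMeasure`; species are bounded measurable).
-/

noncomputable section

namespace Summit.QuantumFields.YangMills.Cruxes.HyperbolicToTorusR.UniquenessTransfer

open scoped BigOperators Topology Manifold Classical MeasureTheory ProbabilityTheory Matrix InnerProductSpace ComplexConjugate ContinuousMap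
open Filter Set Function TopologicalSpace MeasureTheory
open Literature.MathematicalPhysics.QuantumFieldTheory
open Literature.Probability.LatticeModels (Site)
open Literature.MathematicalPhysics.QuantumLattice (LGConfig ZdEdge configShift configShift_apply gaugeTransformZd
  IsZdGaugeInvariant IsCylinder LocalGaugeObservable ymGibbsMeasures infiniteVolumeLimitPoints
  mem_ymGibbsMeasures_of_mem_infiniteVolumeLimitPoints_holds)

/-! ## The route's REPAIRED hyperbolic-family vocabulary, named (byte-identical with `HyperbolicToTorusR`'s `let Fam` / `let Sp`) -/

section Vocabulary

variable (G : Type) [Group G] [TopologicalSpace G] [IsTopologicalGroup G] [CompactSpace G]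
  [MeasurableSpace G] [BorelSpace G]

/-- **The repaired hyperbolic-family vocabulary of route `HyperbolicRegulator`** — byte for byte the `let Fam := …` shared by
`CurvatureAnchorR`, `CurvatureUniformityR` and `HyperbolicToTorusR` (flat `k/2 < dist`, deep `3(k/4) < dist`, chart sup-radius
`k/4`): the PAIR (admissibility predicate A1–A9, clustering predicate of Wilson's `G`-theory in `r` on `S × S` for chart-read
observables at flat base points, distance `dist(x,y) + dist(x',y')`). -/
def Fam (r : LatticeRep G) :=
  fun (k j : ℕ) (V E Q : Finset ℕ) (σ τ : ℕ → ℕ) (bd : ℕ → Fin 4 → ℕ × Bool) (cV : ℕ → ℤ × ℤ → ℕ) (cE : ℕ → ℤ × ℤ → Fin 2 → ℕ × Bool) => let st := fun e : ℕ × Bool => if e.2 then σ e.1 else τ e.1; let en := fun e : ℕ × Bool => if e.2 then τ e.1 else σ e.1; let Γ := SimpleGraph.fromRel fun a b : ℕ => ∃ e ∈ E, σ e = a ∧ τ e = b; let dg := fun x : ℕ => (E.filter fun e => σ e = x ∨ τ e = x).card; let K := V.filter fun x => dg x = 5; let F := fun x : ℕ => x ∈ V ∧ ∀ c ∈ K,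 k / 2 < Γ.dist x c; let Dp := fun x : ℕ => x ∈ V ∧ ∀ c ∈ K, 3 * (k / 4) < Γ.dist x c; let ib := fun a : ℤ × ℤ => |a.1| ≤ (k : ℤ) / 4 ∧ |a.2| ≤ (k : ℤ) / 4; let nx := fun (a : ℤ × ℤ) (μ : Fin 2) => if μ = 0 then (a.1 + 1, a.2) else (a.1, a.2 + 1); let Ed := (ℕ × ℕ) ⊕ (ℕ × ℕ); let PE : Finset Ed := (E ×ˢ V).disjSum (V ×ˢ E); let Cfg := ↥PE → G; let ν := Measure.pi fun _ : ↥PE => haarProbability G; let v := fun (U : Cfg) (e : Ed × Bool) => if h : e.1 ∈ PE then (if e.2 then U ⟨e.1, h⟩ else (U ⟨e.1, h⟩)⁻¹) else 1; let w := fun (U : Cfg) (e : Fin 4 → Ed × Bool) => (r.ρ (v U (e 0) * v U (e 1) * v U (e 2) * v U (e 3))).trace.re; let S := fun U : Cfg => (∑ q ∈ Q, ∑ y ∈ V, w U fun i => (Sum.inl ((bd q i).1, y), (bd q i).2)) + (∑ y ∈ V, ∑ q ∈ Q, w U fun i => (Sum.inr (y, (bd q i).1), (bd q i).2)) + ∑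 e ∈ E, ∑ e' ∈ E, w U ![(Sum.inl (e, σ e'), true), (Sum.inr (τ e, e'), true), (Sum.inl (e, τ e'), false), (Sum.inr (σ e, e'), false)]; let d0 : Fin 4 → Fin 2 := ![0, 1, 0, 1]; let P := fun (x x' : ℕ) (U : Cfg) (p : ZdEdge 4) => let a := (p.1 0, p.1 1); let b := (p.1 2, p.1 3); if p.2 = 0 ∨ p.2 = 1 then v U (Sum.inl ((cE x a (d0 p.2)).1, cV x' b), (cE x a (d0 p.2)).2) else v U (Sum.inr (cV x a, (cE x' b (d0 p.2)).1), (cE x' b (d0 p.2)).2); ((∀ e ∈ E, σ e ∈ V ∧ τ e ∈ V ∧ σ e ≠ τ e) ∧ (∀ q ∈ Q, (∀ i, (bd q i).1 ∈ E) ∧ (∀ i, en (bd q i) = st (bd q (i + 1))) ∧ (st ∘ bd q).Injective) ∧ (∀ e ∈ E, (Q.filter fun q => ∃ i, (bd q i).1 = e).card = 2) ∧ (∀ x ∈ V, (dg x = 4 ∨ dg x = 5) ∧ (Q.filter fun q => ∃ i, st (bd q i) = x).card = dg x) ∧ (∀ x ∈ V, ∃ c ∈ K, Γ.dist x c ≤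 k) ∧ (∀ c ∈ K, ∀ c' ∈ K, c ≠ c' → k ≤ Γ.dist c c') ∧ (∀ f : ℕ → ℝ, ∑ x ∈ V, f x = 0 → ∑ x ∈ V, f x ^ 2 ≤ 10 ^ 6 * (k : ℝ) ^ 2 * ∑ e ∈ E, (f (σ e) - f (τ e)) ^ 2) ∧ (∃ x y, Dp x ∧ Dp y ∧ j ≤ Γ.dist x y) ∧ (∀ x, F x → cV x (0, 0) = x ∧ (∀ a, ib a → cV x a ∈ V) ∧ Set.InjOn (cV x) {a | ib a} ∧ (∀ a μ, ib a → ib (nx a μ) → (cE x a μ).1 ∈ E ∧ st (cE x a μ) = cV x a ∧ en (cE x a μ) = cV x (nx a μ)) ∧ (∀ a, ib a → ib (a.1 + 1, a.2 + 1) → ∃ q ∈ Q, Finset.univ.image (Prod.fst ∘ bd q) = {(cE x a 0).1, (cE x (nx a 0) 1).1, (cE x (nx a 1) 0).1, (cE x a 1).1})), fun (β m C : ℝ) (A B : YMSpecies G) => let X := fun f : Cfg → ℝ => (∫ U, f U * Real.exp (β * S U) ∂ν) / (∫ U, Real.exp (β * S U) ∂ν); ∀ x x' y y', F x → F x' → F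 y → F y' → |X (fun U => A.F (P x x' U) * B.F (P y y' U)) - X (fun U => A.F (P x x' U)) * X (fun U => B.F (P y y' U))| ≤ C * Real.exp (-(m * ((Γ.dist x y + Γ.dist x' y' : ℕ) : ℝ))))

variable {G} in
/-- **Support radius** — byte for byte the route's `let Sp := …`. -/
def Sp : YMSpecies G → ℕ → Prop :=
  fun (A : YMSpecies G) (R : ℕ) => ∀ p ∈ A.supp, ∀ i, |p.1 i| ≤ (R : ℤ)

end Vocabulary

/-! ## Species algebra used by the glue (as in the sibling skeletons): shifted and product gauge-invariant local observables -/

section SpeciesAlgebra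

variable {G : Type} [Group G] [MeasurableSpace G]

/-- The translate `U ↦ B(θ_v U)` of a gauge-invariant local observable is again one. [folklore] -/
def shiftObs (B : LocalGaugeObservable 4 G) (v : Site 4) : LocalGaugeObservable 4 G where
  F := fun U => B.F (configShift v U)
  supp := B.supp.image fun e => (e.1 - v, e.2)
  isCylinder := by
    intro U V h
    refine B.isCylinder fun e he => ?_
    simp only [configShift_apply]
    exact h (e.1 - v, e.2) (Finset.mem_coe.2 (Finset.mem_image_of_mem (fun e : Literature.MathematicalPhysics.QuantumLattice.ZdEdge 4 => (e.1 - v, e.2))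
      (Finset.mem_coe.1 he)))
  gaugeInvariant := by
    intro g U
    have hshift : configShift v (gaugeTransformZd g U) =
        gaugeTransformZd (fun x => g (x - v)) (configShift v U) := by
      funext e
      simp only [configShift_apply, gaugeTransformZd, sub_add_eq_add_sub]
    show B.F (configShift v (gaugeTransformZd g U)) = B.F (configShift v U)
    rw [hshift, B.gaugeInvariant]
  bounded := by
    obtain ⟨C, hC⟩ := B.bounded
    exact ⟨C, fun U => hC _⟩
  measurable := B.measurable.comp (configShift v).measurable

/-- The product of two gauge-invariant local observables is one. [folklore] -/
def prodObs (A B : LocalGaugeObservable 4 G) : LocalGaugeObservable 4 G where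
  F := fun U => A.F U * B.F U
  supp := A.supp ∪ B.supp
  isCylinder := by
    intro U V h
    show A.F U * B.F U = A.F V * B.F V
    rw [A.isCylinder fun e he => h e (by simp [Finset.mem_coe.1 he]),
      B.isCylinder fun e he => h e (by simp [Finset.mem_coe.1 he])]
  gaugeInvariant := by
    intro g U
    show A.F (gaugeTransformZd g U) * B.F (gaugeTransformZd g U) = A.F U * B.F U
    rw [A.gaugeInvariant, B.gaugeInvariant]
  bounded := by
    obtain ⟨a, ha⟩ := A.bounded
    obtain ⟨b, hb⟩ := B.bounded
    refine ⟨a * b, fun U => ?_⟩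
    rw [abs_mul]
    exact mul_le_mul (ha U) (hb U) (abs_nonneg _) ((abs_nonneg _).trans (ha U))
  measurable := A.measurable.mul B.measurable

@[simp] theorem shiftObs_F (B : LocalGaugeObservable 4 G) (v : Site 4) (U : LGConfig 4 G) :
    (shiftObs B v).F U = B.F (configShift v U) := rfl

@[simp] theorem prodObs_F (A B : LocalGaugeObservable 4 G) (U : LGConfig 4 G) :
    (prodObs A B).F U = A.F U * B.F U := rfl

end SpeciesAlgebra

/-! ## The three stub STATEMENTS (named `Prop`s; the registered stubs below repeat them verbatim) -/

/-- **(H) Chart-local limit state — statement (buildable now).**  For every compact simple `G` (any Borel σ-algebra — the crux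
instantiates `borel G`), faithful unitary `r`, every hyperbolic family admissible at all scales `k ≥ 8`, coupling `β`, rate `m > 0`, and the
crux's `k`-UNIFORM clustering table at `(β, m)` (VERBATIM the body of `HyperbolicToTorusR`'s hypothesis at `β`): for every
pair of species `(A, B)` there is a DLR state of Wilson's specification on `ℤ⁴` at `β` in which `(A, τₙB)` cluster in
Euclidean time at the SAME rate `m` for all `n` (`τₙ = configShift (-n e₀)`, the convention of `latticeConnectedCorr`). -/
def ChartLimitState : Prop :=
  ∀ (G : Type) [Group G] [TopologicalSpace G] [IsTopologicalGroup G] [CompactSpace G]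
    [MeasurableSpace G] [BorelSpace G], IsCompactSimpleLieGroup G →
  ∀ (r : LatticeRep G) (V E Q : ℕ → ℕ → Finset ℕ) (σ τ : ℕ → ℕ → ℕ → ℕ)
  (bd : ℕ → ℕ → ℕ → Fin 4 → ℕ × Bool) (cV : ℕ → ℕ → ℕ → ℤ × ℤ → ℕ)
  (cE : ℕ → ℕ → ℕ → ℤ × ℤ → Fin 2 → ℕ × Bool),
  (∀ k j, 8 ≤ k → (Fam G r k j (V k j) (E k j) (Q k j) (σ k j) (τ k j) (bd k j) (cV k j) (cE k j)).1) →
  ∀ (β m : ℝ), 0 < m →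
  (∀ A B : YMSpecies G, ∃ C : ℝ, ∃ K : ℕ, ∀ k, K ≤ k → Sp A (k / 8) → Sp B (k / 8) →
    ∃ j₀ : ℕ, ∀ j, j₀ ≤ j → (Fam G r k j (V k j) (E k j) (Q k j) (σ k j) (τ k j) (bd k j) (cV k j) (cE k j)).2 β m C A B) →
  ∀ A B : YMSpecies G, ∃ μ : Measure (LGConfig 4 G), μ ∈ ymGibbsMeasures (d := 4) r.ρ β ∧ ∃ C : ℝ, ∀ n : ℕ,
    |(∫ U, A.F U * B.F (configShift (-Pi.single 0 (n : ℤ)) U) ∂μ) -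
        (∫ U, A.F U ∂μ) * (∫ U, B.F (configShift (-Pi.single 0 (n : ℤ)) U) ∂μ)| ≤ C * Real.exp (-(m * n))

/-- **(U) DLR uniqueness on gauge invariants at weak coupling — statement (OPEN; VERBATIM the sibling's
`FibreToTorus.Uniqueness.GaugeInvariantUniqueness`, one proof closes both).**  For every compact simple `G` and faithful
unitary `r` there is `β_u` such that at every `β ≥ β_u` any two DLR states of `ymSpecification r.ρ β` on `ℤ⁴` have the same
expectation of every bounded measurable gauge-invariant cylinder observable.  Open beyond strong coupling (Seiler LNP 159
Ch. 2–3; Chatterjee arXiv:1803.01950 §2, §6; strong coupling: Osterwalder–Seiler 1978 Thm 3.5). -/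
def GaugeInvariantUniqueness : Prop :=
  ∀ (G : Type) [Group G] [TopologicalSpace G] [IsTopologicalGroup G] [CompactSpace G]
    [MeasurableSpace G] [BorelSpace G], IsCompactSimpleLieGroup G → ∀ r : LatticeRep G,
    ∃ βu : ℝ, ∀ β : ℝ, βu ≤ β → ∀ μ ν : MeasureTheory.Measure (LGConfig 4 G),
      μ ∈ ymGibbsMeasures (d := 4) r.ρ β → ν ∈ ymGibbsMeasures (d := 4) r.ρ β →
        ∀ A : YMSpecies G, ∫ U, A.F U ∂μ = ∫ U, A.F U ∂ν

/-- **(V) Finite-size passage — statement (OPEN; VERBATIM the sibling's `TorusFiniteSize` = `birth`'s `VacuumDominance`,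
one proof closes all).**  IF at every `β ≥ β₃` one rate `m > 0` clusters every periodic infinite-volume limit point on
gauge-invariant local observables with constants uniform over the limit points, THEN the `UniformLatticeGap` body holds at
`(G, r)` — the crux's conclusion. -/
def TorusFiniteSize : Prop :=
  ∀ (G : Type) [Group G] [TopologicalSpace G] [IsTopologicalGroup G] [CompactSpace G]
    [MeasurableSpace G] [BorelSpace G], IsCompactSimpleLieGroup G → ∀ (r : LatticeRep G) (β₃ : ℝ),
    (∀ β : ℝ, β₃ ≤ β → ∃ m : ℝ, 0 < m ∧
      ∀ A B : YMSpecies G, ∃ C : ℝ, ∀ μ : MeasureTheory.Measure (LGConfig 4 G),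
        μ ∈ infiniteVolumeLimitPoints (d := 4) r.ρ β → ∀ n : ℕ,
          |(∫ U, A.F U * B.F (configShift (-Pi.single 0 (n : ℤ)) U) ∂μ) -
              (∫ U, A.F U ∂μ) * (∫ U, B.F (configShift (-Pi.single 0 (n : ℤ)) U) ∂μ)| ≤
            C * Real.exp (-(m * n))) →
    ∃ β₀ : ℝ, ∀ β : ℝ, β₀ ≤ β → ∃ m : ℝ, 0 < m ∧ ∃ S₁ : ℕ, ∀ A B : YMSpecies G, ∃ C : ℝ,
      ∀ S n : ℕ, S₁ ≤ S → n ≤ S →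
        |latticeConnectedCorr r.ρ β (2 * S + 1) A.F B.F n| ≤ C * Real.exp (-(m * n))

/-! ## The three REGISTERED STUBS (the ONLY `sorry`s of this file; signatures = the statements above, verbatim) -/

/-- Registered stub `stub_chartLimitState` : the statement `ChartLimitState` written out (buildable now; the hyperbolic
analogue of the sibling's landed `stub_tubeLimitState`). -/
theorem stub_chartLimitState :
    ∀ (G : Type) [Group G] [TopologicalSpace G] [IsTopologicalGroup G] [CompactSpace G]
      [MeasurableSpace G] [BorelSpace G], IsCompactSimpleLieGroup G →
    ∀ (r : LatticeRep G) (V E Q : ℕ → ℕ → Finset ℕ) (σ τ : ℕ → ℕ → ℕ → ℕ)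
    (bd : ℕ → ℕ → ℕ → Fin 4 → ℕ × Bool) (cV : ℕ → ℕ → ℕ → ℤ × ℤ → ℕ)
    (cE : ℕ → ℕ → ℕ → ℤ × ℤ → Fin 2 → ℕ × Bool),
    (∀ k j, 8 ≤ k → (Fam G r k j (V k j) (E k j) (Q k j) (σ k j) (τ k j) (bd k j) (cV k j) (cE k j)).1) →
    ∀ (β m : ℝ), 0 < m →
    (∀ A B : YMSpecies G, ∃ C : ℝ, ∃ K : ℕ, ∀ k, K ≤ k → Sp A (k / 8) → Sp B (k / 8) →
      ∃ j₀ : ℕ, ∀ j, j₀ ≤ j → (Fam G r k j (V k j) (E k j) (Q k j) (σ k j) (τ k j) (bd k j) (cV k j) (cE k j)).2 β m C A B) →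
    ∀ A B : YMSpecies G, ∃ μ : Measure (LGConfig 4 G), μ ∈ ymGibbsMeasures (d := 4) r.ρ β ∧ ∃ C : ℝ, ∀ n : ℕ,
      |(∫ U, A.F U * B.F (configShift (-Pi.single 0 (n : ℤ)) U) ∂μ) -
          (∫ U, A.F U ∂μ) * (∫ U, B.F (configShift (-Pi.single 0 (n : ℤ)) U) ∂μ)| ≤ C * Real.exp (-(m * n)) := by
  sorry

/-- Registered stub `stub_gaugeInvariantUniqueness` : the statement `GaugeInvariantUniqueness` written out (OPEN; shared
verbatim with `Cruxes/FibreToTorus/Lines/uniqueness.lean`). -/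
theorem stub_gaugeInvariantUniqueness :
    ∀ (G : Type) [Group G] [TopologicalSpace G] [IsTopologicalGroup G] [CompactSpace G]
      [MeasurableSpace G] [BorelSpace G], IsCompactSimpleLieGroup G → ∀ r : LatticeRep G,
      ∃ βu : ℝ, ∀ β : ℝ, βu ≤ β → ∀ μ ν : MeasureTheory.Measure (LGConfig 4 G),
        μ ∈ ymGibbsMeasures (d := 4) r.ρ β → ν ∈ ymGibbsMeasures (d := 4) r.ρ β →
          ∀ A : YMSpecies G, ∫ U, A.F U ∂μ = ∫ U, A.F U ∂ν := by
  sorry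

/-- Registered stub `stub_torusFiniteSize` : the statement `TorusFiniteSize` written out (OPEN; shared verbatim with the
sibling's `birth` / `uniqueness` / `Sketch` lines). -/
theorem stub_torusFiniteSize :
    ∀ (G : Type) [Group G] [TopologicalSpace G] [IsTopologicalGroup G] [CompactSpace G]
      [MeasurableSpace G] [BorelSpace G], IsCompactSimpleLieGroup G → ∀ (r : LatticeRep G) (β₃ : ℝ),
      (∀ β : ℝ, β₃ ≤ β → ∃ m : ℝ, 0 < m ∧
        ∀ A B : YMSpecies G, ∃ C : ℝ, ∀ μ : MeasureTheory.Measure (LGConfig 4 G),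
          μ ∈ infiniteVolumeLimitPoints (d := 4) r.ρ β → ∀ n : ℕ,
            |(∫ U, A.F U * B.F (configShift (-Pi.single 0 (n : ℤ)) U) ∂μ) -
                (∫ U, A.F U ∂μ) * (∫ U, B.F (configShift (-Pi.single 0 (n : ℤ)) U) ∂μ)| ≤
              C * Real.exp (-(m * n))) →
      ∃ β₀ : ℝ, ∀ β : ℝ, β₀ ≤ β → ∃ m : ℝ, 0 < m ∧ ∃ S₁ : ℕ, ∀ A B : YMSpecies G, ∃ C : ℝ,
        ∀ S n : ℕ, S₁ ≤ S → n ≤ S →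
          |latticeConnectedCorr r.ρ β (2 * S + 1) A.F B.F n| ≤ C * Real.exp (-(m * n)) := by
  sorry

/-! ## Signature match (kernel-checked): each registered stub IS its named statement -/

example : ChartLimitState := stub_chartLimitState
example : GaugeInvariantUniqueness := stub_gaugeInvariantUniqueness
example : TorusFiniteSize := stub_torusFiniteSize

/-! ## Name-keyed aliases of the stub statements — the hypotheses of `HyperbolicToTorusR_of` -/
namespace __Registered

/-- Alias of `ChartLimitState` keyed by the registered stub name. -/
abbrev stub_chartLimitState : Prop := ChartLimitState
/-- Alias of `GaugeInvariantUniqueness` keyed by the registered stub name. -/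
abbrev stub_gaugeInvariantUniqueness : Prop := GaugeInvariantUniqueness
/-- Alias of `TorusFiniteSize` keyed by the registered stub name. -/
abbrev stub_torusFiniteSize : Prop := TorusFiniteSize

end __Registered

/-! ## Composition: the crux BY NAME from the three stub statements (no `sorry` below this line) -/

/-- **`HyperbolicToTorusR_of : (H) → (U) → (V) → HyperbolicToTorusR`.**  Fix `G`, `hG`, `r`, the Borel σ-algebra (the
crux's own `letI := borel G`), the family and its two hypotheses; `β₁` from the clustering hypothesis, `β_u` from (U); at each
`β ≥ max β₁ β_u` and for each pair `(A, B)`, (H) turns the family at the family's rate `m(β)` into a DLR state `μ` in which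
`(A, τₙB)` cluster at rate `m(β)`; every periodic limit point `ν` is DLR (landed theorem), so by (U) it has the same
expectations of `A`, `τₙB`, `A·τₙB` (`shiftObs`, `prodObs`) as `μ` and clusters with `μ`'s constant; (V) at threshold
`max β₁ β_u` is the crux's conclusion for `r`.  Conclusion = the route decl, by name; the named `Fam`/`Sp` and the crux's
inlined `let Fam`/`let Sp` agree by definitional unfolding. -/
theorem HyperbolicToTorusR_of (hH : __Registered.stub_chartLimitState)
    (hU : __Registered.stub_gaugeInvariantUniqueness) (hV : __Registered.stub_torusFiniteSize) :
    Summit.QuantumFields.YangMills.Theses.HyperbolicRegulator.HyperbolicToTorusR := by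
  intro G _ _ _ _ hG r Fam₀ Sp₀ V E Q σ τ bd cV cE Φ hAdm hClust
  letI : MeasurableSpace G := borel G
  haveI : BorelSpace G := ⟨rfl⟩
  obtain ⟨β₁, hβ₁⟩ := hClust
  -- `G` is Hausdorff and second countable: `r.ρ` is a closed embedding into a matrix space
  haveI : T2Space G := (r.continuous.isClosedEmbedding r.injective).isEmbedding.t2Space
  haveI : SecondCountableTopology G :=
    (r.continuous.isClosedEmbedding r.injective).isEmbedding.secondCountableTopology
  obtain ⟨βu, hβu⟩ := hU G hG r
  -- (V) at threshold `max β₁ βu`; its hypothesis is supplied by (H) + (U)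
  refine hV G hG r (max β₁ βu) ?_
  intro β hβ
  obtain ⟨m, hm, hCl⟩ := hβ₁ β ((le_max_left _ _).trans hβ)
  refine ⟨m, hm, fun A B => ?_⟩
  -- (H): a DLR state in which `(A, τₙB)` cluster at the family's rate
  obtain ⟨μ, hμG, C, hC⟩ := hH G hG r V E Q σ τ bd cV cE hAdm β m hm hCl A B
  refine ⟨C, fun ν hν n => ?_⟩
  -- periodic limit points are DLR states (landed theorem)
  have hνG : ν ∈ ymGibbsMeasures (d := 4) r.ρ β :=
    mem_ymGibbsMeasures_of_mem_infiniteVolumeLimitPoints_holds (d := 4) r.ρ r.continuous hν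
  have hUβ : ∀ X : YMSpecies G, ∫ U, X.F U ∂ν = ∫ U, X.F U ∂μ :=
    hβu β ((le_max_right _ _).trans hβ) ν μ hνG hμG
  have h1 : ∫ U, A.F U ∂ν = ∫ U, A.F U ∂μ := hUβ A
  have h2 := hUβ (shiftObs B (-Pi.single 0 (n : ℤ)))
  simp only [shiftObs_F] at h2
  have h3 := hUβ (prodObs A (shiftObs B (-Pi.single 0 (n : ℤ))))
  simp only [prodObs_F, shiftObs_F] at h3
  rw [h1, h2, h3]
  exact hC n

/-- **Registered instantiation (kernel-checked)**: the three stubs BY NAME give the crux BY NAME. -/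
example : Summit.QuantumFields.YangMills.Theses.HyperbolicRegulator.HyperbolicToTorusR :=
  HyperbolicToTorusR_of stub_chartLimitState stub_gaugeInvariantUniqueness stub_torusFiniteSize

end Summit.QuantumFields.YangMills.Cruxes.HyperbolicToTorusR.UniquenessTransfer

end
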